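import Mathlib
import Literature.MathematicalPhysics.QuantumFieldTheory.King1986.EffectiveLaplacianRate

/-!
# Beta / PropagatorWoodburyFibre — the Woodbury ∕ Schur-complement FIBRE CALCULUS of constrained Gaussian
covariances: KKT blocks, the COMPOSITION (quotient) law of block averagings, the King-type deviation identities,
the exact colour-fibre reduction, and the scalar fibre = King's `effSymbol`

Cell `pub-balaban` (Bałaban lattice Yang–Mills UV-stability audit), β sub-cell, BINDER ROW **G-an2-4 ∕ (CONV-C)** «non-abelian
one-step η-rate comparison of the constituent kernels `(G_k, H_k, C^{(k)})` at `U = 1` — NOT IN PRINT», prover part **P3 =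
WOODBURY-FIBRE reduction** (unit `b2b-balaban-gan24-p3`).  HONEST FRAMING (verbatim, page 1 of everything this cell writes):
discharging `BetaPertH` makes Bałaban's UV stability UNCONDITIONAL — a real constructive-QFT result; it is NOT the continuum
limit and NOT the Clay problem.  (CONV-C) is an OPEN analytic input of the β-function wall; this file does NOT discharge it.
HONEST DEPENDENCY: continuum YM on T⁴ ⇐ BetaPertH ∧ nine spine estimates (0/9 proved); BetaPertH ⇐ (D1) ∧ (D4) ∧ CAP+tail;
G-an2-4 gates asym, D1 and NE2/3/4.  ABSOLUTE RULE honoured: nothing printed and nothing programme-internal is used as a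
hypothesis; every declaration below is `[folklore]` finite-dimensional linear algebra (Mathlib `Matrix`), kernel-checked.

## Why this file (the fibre picture of one blocking step at `U = 1`)

At `U = 1` every linear one-step object of Bałaban's renormalization transformation is translation-covariant under the coarse
lattice, hence block-diagonal over Bloch momenta; on ONE Bloch fibre the gauge-fixed block-averaging KKT system is a FINITE square
matrix (cell: `Beta.BlochFibreMatrix.fibreMatrix`, `FibreInverseDecay.trigPolySymbol`), and the packed one-step resolvent
`Beta.OneStepResolventKernel.KInv N` has the block shape `[[Γ, ℋ], [ℋ♭, 𝒮]]` (fluctuation covariance, minimiser, multiplier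
response `𝒮 = −Δ_eff`).  For a fine quadratic form `H` (one fibre) and constraint rows `Q` (block averages) these blocks are the
RATIONAL functions
  `pivot H Q = Q H⁻¹ Qᴴ` (Bałaban's `QGQ*`; King's alias sum `Σ_l |u|²/Δ^η` [cite: King1986, (4.5) p.670]),
  `effForm = (pivot)⁻¹` (the effective coarse form for δ-function constraints), `minimiser = H⁻¹Qᴴ·effForm` (the `H_k`-type
  kernel), `flucCov = H⁻¹ − H⁻¹Qᴴ·effForm·QH⁻¹` (the `C^{(k)}` ∕ `Γ`-type kernel),
and the soft-constraint variant `effFormSoft a = (a⁻¹·1 + pivot)⁻¹` (weight `exp(−a/2‖QA − B‖²)`; King's (4.5) verbatim in the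
scalar fibre, §8).  WHAT IS PROVED (all fibres = arbitrary finite index types, any field with a star):
* §2 KKT: `[[H, Qᴴ],[Q, 0]] · [[Γ, ℋ],[effForm·Q·H⁻¹, −effForm]] = 1` and the converse product (`kkt_mul_blocks`,
  `blocks_mul_kkt`, `inv_kkt`) — the blocks ARE the packed-resolvent blocks; `Q·Γ = 0`, `Γ·Qᴴ = 0`, `Q·ℋ = 1`, `Γ·H·Γ = Γ`,
  `ℋᴴ·H·ℋ = effForm` for Hermitian `H` (B5 (1.65) «⟨B, Δ_kB⟩ = ⟨∂H_kB, ∂H_kB⟩» in matrix form [cite: Balaban1984PropagatorsI,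
  (1.65) p.29] — a LOCATOR of the printed sentence, not a hypothesis).
* §4 THE COMPOSITION ∕ QUOTIENT LAW («block averagings compose»; King's composition law [cite: King1986, (4.12) p.671] in matrix
  form; the READING recorded in the docstring of the cell's `Beta.OneStepKernelFamily.KInvStep`, AT THE FIBRE-MATRIX LEVEL): for
  `Q = Q₂·Q₁`:  `pivot H (Q₂Q₁) = pivot (effForm H Q₁) Q₂`, `effForm H (Q₂Q₁) = effForm (effForm H Q₁) Q₂`,
  `Q₁·flucCov H (Q₂Q₁)·Q₁ᴴ = flucCov (effForm H Q₁) Q₂` (the DECIMATED composite fluctuation covariance IS the genuine one-step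
  covariance over the effective form), `Q₁·minimiser H (Q₂Q₁) = minimiser (effForm H Q₁) Q₂`.
* §5 DEVIATION IDENTITIES (the mechanism of King's Lemma 4.1 (4.11) and Lemma 4.5 (4.39)–(4.40) [cite: King1986, p.671, p.674]
  in matrix form): `effForm H Q − effForm H′ Q = effForm H Q·(pivot H′ Q − pivot H Q)·effForm H′ Q`,
  `pivot H′ Q − pivot H Q = QH⁻¹(H − H′)H′⁻¹Qᴴ`, `flucCov H Q − flucCov H′ Q = flucCov H Q·(H′ − H)·flucCov H′ Q`,
  `minimiser H Q − minimiser H′ Q = flucCov H Q·(H′ − H)·minimiser H′ Q`, and the same for the soft form.  CONSEQUENCE (the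
  reduction): after §4 the scale index of every block of a decimated composite one-step resolvent enters ONLY through the
  effective form `effForm H Q₁` of the earlier steps, and every deviation is a two-sided sandwich of the deviation of that form —
  whose `U = 1` rate is the SCALAR-alias-sum rate already in the tree (`B5ActionRate166.phi162_rate`/`w166_rate`,
  `T4Rate166StripDirect.W166_rate`, built on `King1986.AveragingWeightRate.lemma44` and the (4.7)/(4.31) mechanism of
  `King1986.EffectiveLaplacianRate`).
* SIBLING `PropagatorWoodburyFibreReduction` (§3, §6–§8 there): the Woodbury identity for the SOFT constraint and Bałaban's ∕ King's
  `a·1 − a²·QGQ* = (a⁻¹·1 + QH⁻¹Qᴴ)⁻¹`; POSITIVITY (the certified sizes `pivot ⪰ 0`, `effForm ≻ 0`, `Γ ⪰ 0`, `Δ_a ≻ 0`, `Δ_a ≤ a·1`);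
  the COLOUR fibre `(·) ⊗ 1_c` (exact reduction of the non-abelian `U = 1` kernels to the colourless ones); and the SCALAR fibre
  `effFormSoft = King1986.EffectiveLaplacianRate.effSymbol` with King's Lemma 4.1 `abs_effSymbol_sub_le` BY NAME.

## What this file does NOT give (located; see `HOME/b2b-balaban-gan24-p3/WOODBURY-FIBRE.md`)

(i) No instantiation on the cell's `BlochFibreMatrix` system: its fibre matrix carries, besides `H` and `Q`, the WEAK-GAUGE rows and
the multiplier-normalisation row; the composition law §4 transfers to `dec (Lc^j) (KInv (Lc^(j+1)))` only together with the
factorisation of the composite gauge condition through `Q_j` — THE fibre term not controlled by any scalar rate (it is an exact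
identity to be proved, or it fails and an extra Schur correction from the gauge rows appears).  (ii) No position space: `j`-uniform
decay on `ℤ⁴` needs the strip-analytic Fourier inversion of the one-step symbol over `effForm` (engines `FibreInverseDecay`,
`B4Strip`/`B4TorusKernel`).  (iii) Nothing at `U ≠ 1` (no fibre decomposition).  (iv) No operator-norm version of §5 (the
quadratic-form bounds of §6 are what is certified here).
-/

namespace Summit.QuantumFields.BalabanUV.Beta.PropagatorWoodburyFibre

open Matrix
open scoped Kronecker

section Algebra

variable {𝕜 : Type*} [Field 𝕜] [StarRing 𝕜]
variable {l m n : Type*} [Fintype l] [Fintype m] [Fintype n] [DecidableEq l] [DecidableEq m] [DecidableEq n]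

/-! ## §1 The four fibre objects -/

/-- The PIVOT `Q H⁻¹ Qᴴ` of the constrained system: Bałaban's `QGQ*`, King's alias sum. [folklore] -/
noncomputable def pivot (H : Matrix n n 𝕜) (Q : Matrix m n 𝕜) : Matrix m m 𝕜 := Q * H⁻¹ * Qᴴ

/-- The EFFECTIVE COARSE FORM for δ-function constraints: `(Q H⁻¹ Qᴴ)⁻¹`. [folklore] -/
noncomputable def effForm (H : Matrix n n 𝕜) (Q : Matrix m n 𝕜) : Matrix m m 𝕜 := (pivot H Q)⁻¹

/-- The MINIMISER (`H_k`-type kernel): `H⁻¹ Qᴴ (Q H⁻¹ Qᴴ)⁻¹`. [folklore] -/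
noncomputable def minimiser (H : Matrix n n 𝕜) (Q : Matrix m n 𝕜) : Matrix n m 𝕜 := H⁻¹ * Qᴴ * effForm H Q

/-- The FLUCTUATION COVARIANCE (`Γ` ∕ `C^{(k)}`-type kernel): `H⁻¹ − H⁻¹ Qᴴ (Q H⁻¹ Qᴴ)⁻¹ Q H⁻¹`. [folklore] -/
noncomputable def flucCov (H : Matrix n n 𝕜) (Q : Matrix m n 𝕜) : Matrix n n 𝕜 :=
  H⁻¹ - H⁻¹ * Qᴴ * effForm H Q * Q * H⁻¹

/-- The MULTIPLIER ROW of the bordered inverse: `(Q H⁻¹ Qᴴ)⁻¹ Q H⁻¹` (`= minimiserᴴ` for Hermitian data). [folklore] -/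
noncomputable def comultiplier (H : Matrix n n 𝕜) (Q : Matrix m n 𝕜) : Matrix m n 𝕜 := effForm H Q * Q * H⁻¹

/-- The SOFT effective form `(a⁻¹·1 + Q H⁻¹ Qᴴ)⁻¹` (constraint weight `exp(−a/2‖QA−B‖²)`; King's (4.5) shape). [folklore] -/
noncomputable def effFormSoft (a : 𝕜) (H : Matrix n n 𝕜) (Q : Matrix m n 𝕜) : Matrix m m 𝕜 :=
  (a⁻¹ • (1 : Matrix m m 𝕜) + pivot H Q)⁻¹

/-- The bordered (KKT) matrix `[[H, Qᴴ], [Q, 0]]` of «minimise `½⟨A,HA⟩` subject to `QA = B`». [folklore] -/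
def kkt (H : Matrix n n 𝕜) (Q : Matrix m n 𝕜) : Matrix (n ⊕ m) (n ⊕ m) 𝕜 := fromBlocks H Qᴴ Q 0

/-- The candidate inverse `[[Γ, ℋ], [ℋ♭, −Δ_eff]]` — the packed-resolvent block shape. [folklore] -/
noncomputable def kktBlocks (H : Matrix n n 𝕜) (Q : Matrix m n 𝕜) : Matrix (n ⊕ m) (n ⊕ m) 𝕜 :=
  fromBlocks (flucCov H Q) (minimiser H Q) (comultiplier H Q) (-effForm H Q)

/-- `pivot · effForm = 1`. [folklore] -/
theorem pivot_mul_effForm {H : Matrix n n 𝕜} {Q : Matrix m n 𝕜} (hP : IsUnit (pivot H Q)) :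
    pivot H Q * effForm H Q = 1 :=
  mul_nonsing_inv _ ((isUnit_iff_isUnit_det _).mp hP)

/-- `effForm · pivot = 1`. [folklore] -/
theorem effForm_mul_pivot {H : Matrix n n 𝕜} {Q : Matrix m n 𝕜} (hP : IsUnit (pivot H Q)) :
    effForm H Q * pivot H Q = 1 :=
  nonsing_inv_mul _ ((isUnit_iff_isUnit_det _).mp hP)

/-- `(effForm)⁻¹ = pivot`. [folklore] -/
theorem inv_effForm {H : Matrix n n 𝕜} {Q : Matrix m n 𝕜} (hP : IsUnit (pivot H Q)) :
    (effForm H Q)⁻¹ = pivot H Q :=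
  nonsing_inv_nonsing_inv _ ((isUnit_iff_isUnit_det _).mp hP)

/-- `effForm` is a unit when `pivot` is. [folklore] -/
theorem isUnit_effForm {H : Matrix n n 𝕜} {Q : Matrix m n 𝕜} (hP : IsUnit (pivot H Q)) : IsUnit (effForm H Q) :=
  isUnit_nonsing_inv_iff.mpr hP

/-! ## §2 The KKT block identity and the constraint identities -/

/-- `Q · Γ = 0`: the fluctuation covariance is supported on `ker Q`. [folklore] -/
theorem constraint_mul_flucCov {H : Matrix n n 𝕜} {Q : Matrix m n 𝕜} (hP : IsUnit (pivot H Q)) :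
    Q * flucCov H Q = 0 := by
  have h1 : Q * (H⁻¹ * Qᴴ * effForm H Q * Q * H⁻¹) = (pivot H Q * effForm H Q) * (Q * H⁻¹) := by
    simp only [pivot, Matrix.mul_assoc]
  rw [flucCov, Matrix.mul_sub, h1, pivot_mul_effForm hP, Matrix.one_mul, sub_self]

/-- `Γ · Qᴴ = 0`. [folklore] -/
theorem flucCov_mul_constraint {H : Matrix n n 𝕜} {Q : Matrix m n 𝕜} (hP : IsUnit (pivot H Q)) :
    flucCov H Q * Qᴴ = 0 := by
  have h1 : H⁻¹ * Qᴴ * effForm H Q * Q * H⁻¹ * Qᴴ = H⁻¹ * Qᴴ * (effForm H Q * pivot H Q) := by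
    simp only [pivot, Matrix.mul_assoc]
  rw [flucCov, Matrix.sub_mul, h1, effForm_mul_pivot hP, Matrix.mul_one, sub_self]

/-- `Q · ℋ = 1`: the minimiser reproduces the prescribed averages. [folklore] -/
theorem constraint_mul_minimiser {H : Matrix n n 𝕜} {Q : Matrix m n 𝕜} (hP : IsUnit (pivot H Q)) :
    Q * minimiser H Q = 1 := by
  have h1 : Q * (H⁻¹ * Qᴴ * effForm H Q) = pivot H Q * effForm H Q := by
    simp only [pivot, Matrix.mul_assoc]
  rw [minimiser, h1, pivot_mul_effForm hP]

/-- `ℋ♭ · Qᴴ = 1`. [folklore] -/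
theorem comultiplier_mul_constraint {H : Matrix n n 𝕜} {Q : Matrix m n 𝕜} (hP : IsUnit (pivot H Q)) :
    comultiplier H Q * Qᴴ = 1 := by
  have h1 : effForm H Q * Q * H⁻¹ * Qᴴ = effForm H Q * pivot H Q := by
    simp only [pivot, Matrix.mul_assoc]
  rw [comultiplier, h1, effForm_mul_pivot hP]

/-- `H · Γ = 1 − Qᴴ · ℋ♭`. [folklore] -/
theorem form_mul_flucCov {H : Matrix n n 𝕜} {Q : Matrix m n 𝕜} (hH : IsUnit H) :
    H * flucCov H Q = 1 - Qᴴ * comultiplier H Q := by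
  have hH' := (isUnit_iff_isUnit_det _).mp hH
  have h1 : H * (H⁻¹ * Qᴴ * effForm H Q * Q * H⁻¹) = (H * H⁻¹) * (Qᴴ * (effForm H Q * Q * H⁻¹)) := by
    simp only [Matrix.mul_assoc]
  rw [flucCov, Matrix.mul_sub, mul_nonsing_inv _ hH', h1, mul_nonsing_inv _ hH', Matrix.one_mul, comultiplier]

/-- `Γ · H = 1 − ℋ · Q`. [folklore] -/
theorem flucCov_mul_form {H : Matrix n n 𝕜} {Q : Matrix m n 𝕜} (hH : IsUnit H) :
    flucCov H Q * H = 1 - minimiser H Q * Q := by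
  have hH' := (isUnit_iff_isUnit_det _).mp hH
  have h1 : H⁻¹ * Qᴴ * effForm H Q * Q * H⁻¹ * H = (H⁻¹ * Qᴴ * effForm H Q * Q) * (H⁻¹ * H) := by
    simp only [Matrix.mul_assoc]
  rw [flucCov, Matrix.sub_mul, nonsing_inv_mul _ hH', h1, nonsing_inv_mul _ hH', Matrix.mul_one, minimiser]

/-- `Γ · H · Γ = Γ` (the covariance is the inverse of `H` compressed to `ker Q`). [folklore] -/
theorem flucCov_mul_form_mul_flucCov {H : Matrix n n 𝕜} {Q : Matrix m n 𝕜} (hH : IsUnit H) (hP : IsUnit (pivot H Q)) :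
    flucCov H Q * H * flucCov H Q = flucCov H Q := by
  rw [flucCov_mul_form hH, Matrix.sub_mul, Matrix.one_mul, Matrix.mul_assoc, constraint_mul_flucCov hP, Matrix.mul_zero,
    sub_zero]

/-- **KKT, forward product**: `[[H, Qᴴ],[Q, 0]] · [[Γ, ℋ],[ℋ♭, −Δ_eff]] = 1`. [folklore] -/
theorem kkt_mul_blocks {H : Matrix n n 𝕜} {Q : Matrix m n 𝕜} (hH : IsUnit H) (hP : IsUnit (pivot H Q)) :
    kkt H Q * kktBlocks H Q = 1 := by
  have hH' := (isUnit_iff_isUnit_det _).mp hH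
  rw [kkt, kktBlocks, fromBlocks_multiply, ← fromBlocks_one, fromBlocks_inj]
  refine ⟨?_, ?_, ?_, ?_⟩
  · rw [form_mul_flucCov hH, sub_add_cancel]
  · have h1 : H * minimiser H Q = (H * H⁻¹) * (Qᴴ * effForm H Q) := by simp only [minimiser, Matrix.mul_assoc]
    rw [h1, mul_nonsing_inv _ hH', Matrix.one_mul, Matrix.mul_neg, add_neg_cancel]
  · rw [constraint_mul_flucCov hP, Matrix.zero_mul, add_zero]
  · rw [constraint_mul_minimiser hP, Matrix.zero_mul, add_zero]

/-- **KKT, backward product**: `[[Γ, ℋ],[ℋ♭, −Δ_eff]] · [[H, Qᴴ],[Q, 0]] = 1`. [folklore] -/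
theorem blocks_mul_kkt {H : Matrix n n 𝕜} {Q : Matrix m n 𝕜} (hH : IsUnit H) (hP : IsUnit (pivot H Q)) :
    kktBlocks H Q * kkt H Q = 1 := by
  have hH' := (isUnit_iff_isUnit_det _).mp hH
  rw [kkt, kktBlocks, fromBlocks_multiply, ← fromBlocks_one, fromBlocks_inj]
  refine ⟨?_, ?_, ?_, ?_⟩
  · rw [flucCov_mul_form hH, sub_add_cancel]
  · rw [flucCov_mul_constraint hP, Matrix.mul_zero, add_zero]
  · have h1 : comultiplier H Q * H = effForm H Q * Q * (H⁻¹ * H) := by simp only [comultiplier, Matrix.mul_assoc]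
    rw [h1, nonsing_inv_mul _ hH', Matrix.mul_one, Matrix.neg_mul, add_neg_cancel]
  · rw [comultiplier_mul_constraint hP, Matrix.mul_zero, add_zero]

/-- **The bordered inverse IS the block matrix** `[[Γ, ℋ],[ℋ♭, −Δ_eff]]` (the packed-resolvent shape of the cell's
`Beta.OneStepResolventKernel.KInv`, on one fibre). [folklore] -/
theorem inv_kkt {H : Matrix n n 𝕜} {Q : Matrix m n 𝕜} (hH : IsUnit H) (hP : IsUnit (pivot H Q)) :
    (kkt H Q)⁻¹ = kktBlocks H Q :=
  inv_eq_right_inv (kkt_mul_blocks hH hP)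

/-- The KKT matrix is a unit when `H` and the pivot are. [folklore] -/
theorem isUnit_kkt {H : Matrix n n 𝕜} {Q : Matrix m n 𝕜} (hH : IsUnit H) (hP : IsUnit (pivot H Q)) : IsUnit (kkt H Q) :=
  (Matrix.isUnit_iff_isUnit_det _).mpr (Matrix.isUnit_det_of_right_inverse (kkt_mul_blocks hH hP))

omit [Fintype m] [DecidableEq m] in
/-- For Hermitian `H` the pivot is Hermitian. [folklore] -/
theorem pivot_conjTranspose {H : Matrix n n 𝕜} {Q : Matrix m n 𝕜} (hH : H.IsHermitian) : (pivot H Q)ᴴ = pivot H Q := by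
  rw [pivot, conjTranspose_mul, conjTranspose_mul, conjTranspose_conjTranspose, conjTranspose_nonsing_inv, hH.eq,
    Matrix.mul_assoc]

/-- For Hermitian `H` the effective form is Hermitian. [folklore] -/
theorem effForm_conjTranspose {H : Matrix n n 𝕜} {Q : Matrix m n 𝕜} (hH : H.IsHermitian) :
    (effForm H Q)ᴴ = effForm H Q := by
  rw [effForm, conjTranspose_nonsing_inv, pivot_conjTranspose hH]

/-- For Hermitian `H`: `ℋ♭ = ℋᴴ`. [folklore] -/
theorem comultiplier_eq_conjTranspose {H : Matrix n n 𝕜} {Q : Matrix m n 𝕜} (hH : H.IsHermitian) :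
    comultiplier H Q = (minimiser H Q)ᴴ := by
  rw [minimiser, conjTranspose_mul, conjTranspose_mul, conjTranspose_conjTranspose, conjTranspose_nonsing_inv, hH.eq,
    effForm_conjTranspose hH, comultiplier, Matrix.mul_assoc]

/-- For Hermitian `H` the fluctuation covariance is Hermitian. [folklore] -/
theorem flucCov_conjTranspose {H : Matrix n n 𝕜} {Q : Matrix m n 𝕜} (hH : H.IsHermitian) :
    (flucCov H Q)ᴴ = flucCov H Q := by
  have e : (H⁻¹ * Qᴴ * effForm H Q * Q * H⁻¹)ᴴ = H⁻¹ * Qᴴ * effForm H Q * Q * H⁻¹ := by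
    rw [conjTranspose_mul, conjTranspose_mul, conjTranspose_mul, conjTranspose_mul, conjTranspose_conjTranspose,
      conjTranspose_nonsing_inv, hH.eq, effForm_conjTranspose hH]
    simp only [Matrix.mul_assoc]
  rw [flucCov, conjTranspose_sub, conjTranspose_nonsing_inv, hH.eq, e]

/-- **B5 (1.65) in matrix form**: the effective form is the `H`-energy of the minimiser, `ℋᴴ H ℋ = Δ_eff`
(«⟨B, Δ_kB⟩ = ⟨∂H_kB, ∂H_kB⟩» [cite: Balaban1984PropagatorsI, (1.65) p.29] — locator only). [folklore] -/
theorem minimiser_energy {H : Matrix n n 𝕜} {Q : Matrix m n 𝕜} (hH : IsUnit H) (hHh : H.IsHermitian)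
    (hP : IsUnit (pivot H Q)) : (minimiser H Q)ᴴ * H * minimiser H Q = effForm H Q := by
  have hH' := (isUnit_iff_isUnit_det _).mp hH
  rw [← comultiplier_eq_conjTranspose hHh]
  have h1 : comultiplier H Q * H * minimiser H Q = effForm H Q * (Q * (H⁻¹ * H) * (H⁻¹ * Qᴴ)) * effForm H Q := by
    simp only [comultiplier, minimiser, Matrix.mul_assoc]
  rw [h1, nonsing_inv_mul _ hH', Matrix.mul_one, show Q * (H⁻¹ * Qᴴ) = pivot H Q by rw [pivot, Matrix.mul_assoc],
    effForm_mul_pivot hP, Matrix.one_mul]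

/-! ## §4 The composition ∕ quotient law: block averagings compose -/

omit [Fintype l] [DecidableEq l] [DecidableEq m] in
/-- `pivot H (Q₂Q₁) = Q₂ · pivot H Q₁ · Q₂ᴴ`. [folklore] -/
theorem pivot_comp (H : Matrix n n 𝕜) (Q₁ : Matrix m n 𝕜) (Q₂ : Matrix l m 𝕜) :
    pivot H (Q₂ * Q₁) = Q₂ * pivot H Q₁ * Q₂ᴴ := by
  rw [pivot, pivot, conjTranspose_mul]; simp only [Matrix.mul_assoc]

omit [Fintype l] [DecidableEq l] in
/-- **COMPOSITION LAW for the pivot**: the pivot of the composite constraint is the pivot, over the EFFECTIVE form of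
the first step, of the second constraint (King (4.12) in matrix form [cite: King1986, (4.12) p.671]). [folklore] -/
theorem pivot_comp_effForm {H : Matrix n n 𝕜} {Q₁ : Matrix m n 𝕜} (hP : IsUnit (pivot H Q₁)) (Q₂ : Matrix l m 𝕜) :
    pivot H (Q₂ * Q₁) = pivot (effForm H Q₁) Q₂ := by
  rw [pivot_comp, pivot, pivot, inv_effForm hP, pivot]

/-- **COMPOSITION LAW for the effective form**: `Δ_eff(H, Q₂Q₁) = Δ_eff(Δ_eff(H, Q₁), Q₂)` — «`k + n` block averagings of
the fine form = `n` block averagings of the `k`-step effective form». [folklore] -/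
theorem effForm_comp {H : Matrix n n 𝕜} {Q₁ : Matrix m n 𝕜} (hP : IsUnit (pivot H Q₁)) (Q₂ : Matrix l m 𝕜) :
    effForm H (Q₂ * Q₁) = effForm (effForm H Q₁) Q₂ := by
  rw [effForm, effForm, pivot_comp_effForm hP]

/-- **COMPOSITION LAW for the fluctuation covariance, decimated**: `Q₁ · Γ(H, Q₂Q₁) · Q₁ᴴ = Γ(Δ_eff(H,Q₁), Q₂)` — the
`Q₁`-marginal of the composite constrained Gaussian is the ONE-STEP fluctuation covariance of the effective form (the READING in
the docstring of the cell's `Beta.OneStepKernelFamily.KInvStep`, at the fibre-matrix level). [folklore] -/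
theorem decimate_flucCov_comp {H : Matrix n n 𝕜} {Q₁ : Matrix m n 𝕜} (hP : IsUnit (pivot H Q₁)) (Q₂ : Matrix l m 𝕜) :
    Q₁ * flucCov H (Q₂ * Q₁) * Q₁ᴴ = flucCov (effForm H Q₁) Q₂ := by
  have e : Q₁ * (H⁻¹ * (Q₂ * Q₁)ᴴ * effForm H (Q₂ * Q₁) * (Q₂ * Q₁) * H⁻¹) * Q₁ᴴ =
      pivot H Q₁ * Q₂ᴴ * effForm H (Q₂ * Q₁) * Q₂ * pivot H Q₁ := by
    rw [conjTranspose_mul]; simp only [pivot, Matrix.mul_assoc]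
  rw [flucCov, Matrix.mul_sub, Matrix.sub_mul, e, effForm_comp hP, flucCov, inv_effForm hP, ← pivot]

/-- **COMPOSITION LAW for the minimiser, decimated**: `Q₁ · ℋ(H, Q₂Q₁) = ℋ(Δ_eff(H,Q₁), Q₂)`. [folklore] -/
theorem decimate_minimiser_comp {H : Matrix n n 𝕜} {Q₁ : Matrix m n 𝕜} (hP : IsUnit (pivot H Q₁)) (Q₂ : Matrix l m 𝕜) :
    Q₁ * minimiser H (Q₂ * Q₁) = minimiser (effForm H Q₁) Q₂ := by
  have e : Q₁ * (H⁻¹ * (Q₂ * Q₁)ᴴ * effForm H (Q₂ * Q₁)) = pivot H Q₁ * Q₂ᴴ * effForm H (Q₂ * Q₁) := by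
    rw [conjTranspose_mul]; simp only [pivot, Matrix.mul_assoc]
  rw [minimiser, e, effForm_comp hP, minimiser, inv_effForm hP]

/-- **COMPOSITION LAW for the multiplier row, decimated**: `ℋ♭(H, Q₂Q₁) · Q₁ᴴ = ℋ♭(Δ_eff(H,Q₁), Q₂)`. [folklore] -/
theorem comultiplier_comp_decimate {H : Matrix n n 𝕜} {Q₁ : Matrix m n 𝕜} (hP : IsUnit (pivot H Q₁)) (Q₂ : Matrix l m 𝕜) :
    comultiplier H (Q₂ * Q₁) * Q₁ᴴ = comultiplier (effForm H Q₁) Q₂ := by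
  have e : effForm H (Q₂ * Q₁) * (Q₂ * Q₁) * H⁻¹ * Q₁ᴴ = effForm H (Q₂ * Q₁) * Q₂ * pivot H Q₁ := by
    simp only [pivot, Matrix.mul_assoc]
  rw [comultiplier, e, effForm_comp hP, comultiplier, inv_effForm hP]

/-- The full one-step block package of the composite system, decimated by `Q₁ ⊕ 1`, is the one-step package over the effective
form: `diag(Q₁,1) · kktBlocks H (Q₂Q₁) · diag(Q₁ᴴ,1) = kktBlocks (Δ_eff(H,Q₁)) Q₂`. [folklore] -/
theorem decimate_kktBlocks_comp {H : Matrix n n 𝕜} {Q₁ : Matrix m n 𝕜} (hP : IsUnit (pivot H Q₁)) (Q₂ : Matrix l m 𝕜) :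
    fromBlocks Q₁ 0 0 (1 : Matrix l l 𝕜) * kktBlocks H (Q₂ * Q₁) * fromBlocks Q₁ᴴ 0 0 (1 : Matrix l l 𝕜) =
      kktBlocks (effForm H Q₁) Q₂ := by
  rw [kktBlocks, kktBlocks, fromBlocks_multiply, fromBlocks_multiply]
  simp only [Matrix.zero_mul, Matrix.mul_zero, add_zero, zero_add, Matrix.one_mul, Matrix.mul_one]
  rw [decimate_flucCov_comp hP, decimate_minimiser_comp hP, comultiplier_comp_decimate hP, effForm_comp hP]

/-! ## §5 Deviation identities (King's Lemma 4.1 ∕ 4.5 mechanism in matrix form) -/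

omit [StarRing 𝕜] in
/-- Resolvent identity for inverses of two forms: `H⁻¹ − H′⁻¹ = H⁻¹ (H′ − H) H′⁻¹`. [folklore] -/
theorem inv_sub_inv_eq {H H' : Matrix n n 𝕜} (hH : IsUnit H) (hH' : IsUnit H') :
    H⁻¹ - H'⁻¹ = H⁻¹ * (H' - H) * H'⁻¹ :=
  Matrix.inv_sub_inv (iff_of_true hH hH')

omit [Fintype m] [DecidableEq m] in
/-- **Deviation of the pivot**: `S′ − S = Q (H′⁻¹ − H⁻¹) Qᴴ = Q H′⁻¹ (H − H′) H⁻¹ Qᴴ`. [folklore] -/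
theorem pivot_sub (H H' : Matrix n n 𝕜) (Q : Matrix m n 𝕜) :
    pivot H' Q - pivot H Q = Q * (H'⁻¹ - H⁻¹) * Qᴴ := by
  rw [pivot, pivot, Matrix.mul_sub, Matrix.sub_mul]

/-- **Deviation of the effective form** (King (4.11): `Δ − Δ̄ = Δ (Δ̄⁻¹ − Δ⁻¹) Δ̄`):
`Δ_eff(H) − Δ_eff(H′) = Δ_eff(H) · (S(H′) − S(H)) · Δ_eff(H′)`. [folklore] -/
theorem effForm_sub {H H' : Matrix n n 𝕜} {Q : Matrix m n 𝕜} (hP : IsUnit (pivot H Q)) (hP' : IsUnit (pivot H' Q)) :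
    effForm H Q - effForm H' Q = effForm H Q * (pivot H' Q - pivot H Q) * effForm H' Q :=
  Matrix.inv_sub_inv (iff_of_true hP hP')

/-- The same for the SOFT effective form: `Δ_a(H) − Δ_a(H′) = Δ_a(H)·(S(H′) − S(H))·Δ_a(H′)` (King's (4.11) exactly). [folklore] -/
theorem effFormSoft_sub {H H' : Matrix n n 𝕜} {Q : Matrix m n 𝕜} {a : 𝕜}
    (hS : IsUnit (a⁻¹ • (1 : Matrix m m 𝕜) + pivot H Q)) (hS' : IsUnit (a⁻¹ • (1 : Matrix m m 𝕜) + pivot H' Q)) :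
    effFormSoft a H Q - effFormSoft a H' Q = effFormSoft a H Q * (pivot H' Q - pivot H Q) * effFormSoft a H' Q := by
  rw [effFormSoft, effFormSoft, Matrix.inv_sub_inv (iff_of_true hS hS'), add_sub_add_left_eq_sub]

/-- **Deviation of the fluctuation covariance** (King's (4.39)–(4.40) with δ-function constraints, cf. the cell's
`T4Cov2156Rate.redCov_sub` in position space): `Γ(H) − Γ(H′) = Γ(H) · (H′ − H) · Γ(H′)`. [folklore] -/
theorem flucCov_sub {H H' : Matrix n n 𝕜} {Q : Matrix m n 𝕜} (hH : IsUnit H) (hH' : IsUnit H')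
    (hP : IsUnit (pivot H Q)) (hP' : IsUnit (pivot H' Q)) :
    flucCov H Q - flucCov H' Q = flucCov H Q * (H' - H) * flucCov H' Q := by
  rw [Matrix.mul_sub, Matrix.sub_mul, Matrix.mul_assoc (flucCov H Q) H', form_mul_flucCov hH', flucCov_mul_form hH,
    Matrix.mul_sub, Matrix.mul_one, Matrix.sub_mul, Matrix.one_mul, ← Matrix.mul_assoc, flucCov_mul_constraint hP,
    Matrix.zero_mul, sub_zero, Matrix.mul_assoc, constraint_mul_flucCov hP', Matrix.mul_zero, sub_zero]

/-- **Deviation of the minimiser**: `ℋ(H) − ℋ(H′) = Γ(H) · (H′ − H) · ℋ(H′)`. [folklore] -/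
theorem minimiser_sub {H H' : Matrix n n 𝕜} {Q : Matrix m n 𝕜} (hH : IsUnit H) (hH' : IsUnit H')
    (hP : IsUnit (pivot H Q)) (hP' : IsUnit (pivot H' Q)) :
    minimiser H Q - minimiser H' Q = flucCov H Q * (H' - H) * minimiser H' Q := by
  have hH'' := (isUnit_iff_isUnit_det _).mp hH'
  have e1 : flucCov H Q * H' * minimiser H' Q = flucCov H Q * (H' * H'⁻¹) * Qᴴ * effForm H' Q := by
    simp only [minimiser, Matrix.mul_assoc]
  have e2 : flucCov H Q * H * minimiser H' Q = (flucCov H Q * H) * minimiser H' Q := by rw [Matrix.mul_assoc]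
  rw [Matrix.mul_sub, Matrix.sub_mul, e1, mul_nonsing_inv _ hH'', Matrix.mul_one, flucCov_mul_constraint hP,
    Matrix.zero_mul, zero_sub, e2, flucCov_mul_form hH, Matrix.sub_mul, Matrix.one_mul, Matrix.mul_assoc,
    constraint_mul_minimiser hP', Matrix.mul_one, neg_sub]

end Algebra

end Summit.QuantumFields.BalabanUV.Beta.PropagatorWoodburyFibre
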